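import Mathlib
import Summits.ValiantsHypothesis.ValiantsHypothesis.Theorems.BinomialElusiveBinomialCandidateJetReductionCoordinates
import Summits.ValiantsHypothesis.ValiantsHypothesis.Theorems.BinomialElusiveBinomialCandidateCrossCapLinearAlgebra
import Summits.ValiantsHypothesis.ValiantsHypothesis.Theorems.BinomialElusiveBinomialCandidateCrossCapKernelCoefficient

/-!
# Crux `BinomialElusive.BinomialCandidate` (stmt-ValiantsHypothesis-7392), line `registered` —
# stub `stub_crossCap`, piece 6: the corank-one normal form of a cross-cap base point

Data of the stub `stub_crossCap` at an integral base point `y₀ = p(0)`: a quadratic map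
`Γ : ℂ^{n₀+1} → ℂ^{n₀+2}`, an integral solution `p` of `Γ(p) = T` (`T` of positive order), a
kernel vector `κ ≠ 0` of the Jacobian `J = (∂_jΓ_i(y₀))` spanning the kernel, and the cross-cap
condition `B(κ,κ) ∉ Im J`.  `crossCap_normalForm` produces the normal form consumed by the
Picard elimination (`crossCap_iteration`): an invertible `P` (target) and, in source coordinates
`S` with `S e_0 = κ` and `P J S = E` (`crossCap_linearAlgebra`), polynomials `B_i` without
monomials of degree `< 2` and series `q_j` of positive order with
`q_j + B_{j+1}(q) = T̂_{j+1}` (`j ≥ 1`), `B_0(q) = T̂_0`, `B_1(q) = T̂_1`, `T̂ = P T`, and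
`(coeff_{Y_0²} B_0, coeff_{Y_0²} B_1) ≠ (0, 0)` — the latter because these coefficients are the
`P`-image of the vector `B(κ,κ) = (homogeneousComponent 2 Γ_i)(κ)` (`crossCap_kernelCoefficient`)
modulo the image of `J`.  The Taylor expansion and the coordinate calculus are those of the
immersive case (`JetReduction.affineTaylor`, …, imported).
-/

-- layout Summits/ValiantsHypothesis/ValiantsHypothesis forces the duplicated namespace component
set_option linter.dupNamespace false

noncomputable section

namespace Summit.ValiantsHypothesis.ValiantsHypothesis.Theorems.BinomialCandidateStubs

open scoped BigOperators
open MvPolynomial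

namespace CrossCap

/-- A linear form has no `X_0²`-coefficient. -/
theorem coeff_single_two_linear {n₀ : ℕ} (c : Fin (n₀ + 1) → ℂ) :
    MvPolynomial.coeff (Finsupp.single 0 2) (∑ l, C (c l) * X l : MvPolynomial (Fin (n₀ + 1)) ℂ) = 0 := by
  classical
  rw [coeff_sum]
  refine Finset.sum_eq_zero fun l _ => ?_
  rw [coeff_C_mul, coeff_X, if_neg, mul_zero]
  intro h
  have := Finsupp.single_eq_single_iff _ _ _ _ |>.mp h
  omega

section LinearE

variable {n₀ : ℕ} (E : Matrix (Fin (n₀ + 2)) (Fin (n₀ + 1)) ℂ) (hE0 : ∀ i, E i 0 = 0)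
  (hEs : ∀ i (l' : Fin n₀), E i l'.succ = if i = l'.succ.succ then 1 else 0)
include hE0 hEs

/-- The `E`-linear form of the target index `0` vanishes. -/
theorem linear_E_zero : (∑ l, C (E 0 l) * X l : MvPolynomial (Fin (n₀ + 1)) ℂ) = 0 := by
  rw [Fin.sum_univ_succ, hE0, C_0, zero_mul, zero_add]
  simp_rw [hEs]
  simp [(Fin.succ_ne_zero _).symm]

/-- The `E`-linear form of the target index `1` vanishes. -/
theorem linear_E_one : (∑ l, C (E 1 l) * X l : MvPolynomial (Fin (n₀ + 1)) ℂ) = 0 := by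
  rw [Fin.sum_univ_succ, hE0, C_0, zero_mul, zero_add]
  simp_rw [hEs]
  have h : ∀ l' : Fin n₀, ((1 : Fin (n₀ + 2)) = l'.succ.succ) = False := fun l' => by
    rw [← Fin.succ_zero_eq_one, eq_iff_iff, iff_false, Fin.succ_inj]
    exact (Fin.succ_ne_zero _).symm
  simp [h]

/-- The `E`-linear form of the target index `j + 2` is `X_{j+1}`. -/
theorem linear_E_succ_succ (j' : Fin n₀) :
    (∑ l, C (E j'.succ.succ l) * X l : MvPolynomial (Fin (n₀ + 1)) ℂ) = X j'.succ := by
  rw [Fin.sum_univ_succ, hE0, C_0, zero_mul, zero_add]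
  simp_rw [hEs]
  have h : ∀ l' : Fin n₀, (j'.succ.succ = l'.succ.succ) = (l' = j') := fun l' => by
    rw [eq_iff_iff, Fin.succ_inj, Fin.succ_inj, eq_comm]
  simp [h, Finset.sum_ite_eq']

end LinearE

end CrossCap

open CrossCap JetReduction in
/-- **Corank-one normal form of a cross-cap base point** (piece 6 of the stub `stub_crossCap`);
see the module docstring. -/
theorem crossCap_normalForm :
    ∀ (n₀ : ℕ) (Γ : Fin (n₀ + 2) → MvPolynomial (Fin (n₀ + 1)) ℂ)
      (p : Fin (n₀ + 1) → LaurentSeries ℂ) (T : Fin (n₀ + 2) → LaurentSeries ℂ)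
      (κ : Fin (n₀ + 1) → ℂ),
      (∀ i, (Γ i).totalDegree ≤ 2) → (∀ j, 0 ≤ (p j).order) →
      (∀ i, ∀ g : ℤ, g < 1 → (T i).coeff g = 0) →
      (∀ i, MvPolynomial.aeval p (Γ i) = T i) → κ ≠ 0 →
      (∀ i, ∑ j, κ j * MvPolynomial.eval (fun l => (p l).coeff 0)
        (MvPolynomial.pderiv j (Γ i)) = 0) →
      (∀ κ' : Fin (n₀ + 1) → ℂ, (∀ i, ∑ j, κ' j * MvPolynomial.eval (fun l => (p l).coeff 0)
        (MvPolynomial.pderiv j (Γ i)) = 0) → ∃ μ : ℂ, κ' = μ • κ) →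
      (¬ ∃ v : Fin (n₀ + 1) → ℂ, ∀ i,
        MvPolynomial.eval κ (MvPolynomial.homogeneousComponent 2 (Γ i)) =
          ∑ j, v j * MvPolynomial.eval (fun l => (p l).coeff 0) (MvPolynomial.pderiv j (Γ i))) →
      ∃ (P P' : Matrix (Fin (n₀ + 2)) (Fin (n₀ + 2)) ℂ)
        (B : Fin (n₀ + 2) → MvPolynomial (Fin (n₀ + 1)) ℂ) (q : Fin (n₀ + 1) → LaurentSeries ℂ),
        P * P' = 1 ∧ P' * P = 1 ∧
        (∀ i, ∀ d : Fin (n₀ + 1) →₀ ℕ, d.degree < 2 → MvPolynomial.coeff d (B i) = 0) ∧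
        (∀ j, ∀ g : ℤ, g < 1 → (q j).coeff g = 0) ∧
        (∀ j' : Fin n₀, q j'.succ + MvPolynomial.aeval q (B j'.succ.succ) =
          ∑ i', algebraMap ℂ (LaurentSeries ℂ) (P j'.succ.succ i') * T i') ∧
        MvPolynomial.aeval q (B 0) = ∑ i', algebraMap ℂ (LaurentSeries ℂ) (P 0 i') * T i' ∧
        MvPolynomial.aeval q (B 1) = ∑ i', algebraMap ℂ (LaurentSeries ℂ) (P 1 i') * T i' ∧
        (MvPolynomial.coeff (Finsupp.single 0 2) (B 0) ≠ 0 ∨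
          MvPolynomial.coeff (Finsupp.single 0 2) (B 1) ≠ 0) := by
  intro n₀ Γ p T κ hΓ hp hT hsol hκ hker hcorank hcross
  classical
  have hF := JetReduction.laurentGE_isFilt
  set F : ℕ → LaurentSeries ℂ → Prop := fun m z => ∀ g : ℤ, g < m → z.coeff g = 0 with hFdef
  set y₀ : Fin (n₀ + 1) → ℂ := fun l => (p l).coeff 0 with hy₀
  set J : Matrix (Fin (n₀ + 2)) (Fin (n₀ + 1)) ℂ := Matrix.of fun i j => eval y₀ (pderiv j (Γ i))
    with hJ
  -- the kernel hypotheses in matrix form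
  have hJmul : ∀ v : Fin (n₀ + 1) → ℂ, ∀ i, J.mulVec v i = ∑ j, v j * eval y₀ (pderiv j (Γ i)) :=
    fun v i => by
      simp only [Matrix.mulVec, dotProduct, hJ, Matrix.of_apply]
      exact Finset.sum_congr rfl fun j _ => mul_comm _ _
  have hJκ : J.mulVec κ = 0 := funext fun i => by rw [hJmul]; exact hker i
  have hcorank' : ∀ κ' : Fin (n₀ + 1) → ℂ, J.mulVec κ' = 0 → ∃ μ : ℂ, κ' = μ • κ :=
    fun κ' h => hcorank κ' fun i => by rw [← hJmul]; exact congrFun h i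
  obtain ⟨P, P', S, S', hPP', hP'P, hSS', hS'S, hS0, hE0, hEs⟩ :=
    crossCap_linearAlgebra n₀ J κ hκ hJκ hcorank'
  -- the base point and the translated solution
  set q₀ : Fin (n₀ + 1) → LaurentSeries ℂ := fun j => p j - algebraMap ℂ (LaurentSeries ℂ) (y₀ j)
    with hq₀
  have q₀_mem : ∀ j, F 1 (q₀ j) := by
    intro j g hg
    simp only [hq₀, HahnSeries.coeff_sub', Pi.sub_apply, AffinePeeling.algebraMap_laurentSeries_apply]
    by_cases hg0 : g = 0
    · subst hg0
      rw [HahnSeries.coeff_single_same, hy₀, sub_self]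
    · rw [HahnSeries.coeff_single_of_ne hg0, sub_zero]
      exact HahnSeries.coeff_eq_zero_of_lt_order (lt_of_lt_of_le (by push_cast at hg; omega) (hp j))
  have hT' : ∀ i, F 1 (T i) := fun i g hg => hT i g (by exact_mod_cast hg)
  -- source coordinates `S`, Taylor expansion
  set lam : Fin (n₀ + 1) → MvPolynomial (Fin (n₀ + 1)) ℂ := fun j => ∑ l, C (S j l) * X l with hlam
  set Γt : Fin (n₀ + 2) → MvPolynomial (Fin (n₀ + 1)) ℂ :=
    fun i => aeval (fun j => C (y₀ j) + lam j) (Γ i) with hΓt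
  set Lin : Fin (n₀ + 2) → MvPolynomial (Fin (n₀ + 1)) ℂ :=
    fun i => ∑ j, C (eval y₀ (pderiv j (Γ i))) * lam j with hLin
  set q : Fin (n₀ + 1) → LaurentSeries ℂ := fun j => ∑ l, algebraMap ℂ (LaurentSeries ℂ) (S' j l) * q₀ l
    with hq
  have lam_mem : ∀ j, ∀ d : Fin (n₀ + 1) →₀ ℕ, d.degree < 1 → coeff d (lam j) = 0 := fun j =>
    degGE_sum _ fun l _ => degGE_C_mul _ (degGE_X l)
  have Lin_mem : ∀ i, ∀ d : Fin (n₀ + 1) →₀ ℕ, d.degree < 1 → coeff d (Lin i) = 0 := fun i =>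
    degGE_sum _ fun j _ => degGE_C_mul _ (lam_mem j)
  have taylor : ∀ i, ∀ d : Fin (n₀ + 1) →₀ ℕ, d.degree < 2 →
      coeff d (Γt i - (C (eval y₀ (Γ i)) + Lin i)) = 0 := fun i =>
    affineTaylor y₀ lam lam_mem (Γ i)
  have q_mem : ∀ j, F 1 (q j) := fun j =>
    filt_sum hF _ _ fun l _ => filt_algebraMap_mul hF _ (q₀_mem l)
  have aeval_q_phi : ∀ j, aeval q (C (y₀ j) + lam j) = p j := fun j => by
    rw [map_add, aeval_C, hlam, aeval_linear, hq]
    simp only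
    rw [sum_algebraMap_mul_sum hSS' q₀ j, hq₀]
    simp only [add_sub_cancel]
  have aeval_q_Γt : ∀ i, aeval q (Γt i) = T i := fun i => by
    rw [hΓt]
    simp only
    rw [aeval_aeval]
    simp_rw [aeval_q_phi]
    exact hsol i
  have eval_y₀ : ∀ i, eval y₀ (Γ i) = 0 := fun i => by
    have h1 : F 1 (aeval q (Γt i - (C (eval y₀ (Γ i)) + Lin i))) :=
      hF.2.2.2.1 1 2 _ one_le_two (filt_aeval hF (taylor i) q_mem)
    have h2 : F 1 (aeval q (Lin i)) := filt_aeval hF (Lin_mem i) q_mem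
    have h3 := filt_sub hF (filt_sub hF (hT' i) h1) h2
    rw [map_sub, map_add, aeval_C, aeval_q_Γt] at h3
    have h4 : F 1 (algebraMap ℂ (LaurentSeries ℂ) (eval y₀ (Γ i))) := by
      convert h3 using 1; ring
    have := h4 0 (by norm_num)
    rwa [AffinePeeling.algebraMap_laurentSeries_apply, HahnSeries.coeff_single_same] at this
  have Bt_mem : ∀ i, ∀ d : Fin (n₀ + 1) →₀ ℕ, d.degree < 2 → coeff d (Γt i - Lin i) = 0 := fun i => by
    have := taylor i
    rwa [eval_y₀ i, C_0, zero_add] at this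
  have Lin_eq : ∀ i, Lin i = ∑ l, C ((J * S) i l) * X l := fun i => by
    rw [hLin, hlam]
    simp only [Matrix.mul_apply, hJ, Matrix.of_apply]
    exact sum_C_mul_linear _ _
  -- target coordinates `P`
  set B : Fin (n₀ + 2) → MvPolynomial (Fin (n₀ + 1)) ℂ :=
    fun i => ∑ i', C (P i i') * (Γt i' - Lin i') with hB
  have B_mem : ∀ i, ∀ d : Fin (n₀ + 1) →₀ ℕ, d.degree < 2 → coeff d (B i) = 0 := fun i =>
    degGE_sum _ fun i' _ => degGE_C_mul _ (Bt_mem i')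
  have Linh_eq : ∀ i, ∑ i', C (P i i') * Lin i' = ∑ l, C ((P * J * S) i l) * X l := fun i => by
    simp_rw [Lin_eq]
    rw [sum_C_mul_linear, Matrix.mul_assoc]
    simp only [Matrix.mul_apply]
  have aeval_B : ∀ i, aeval q (B i) + aeval q (∑ l, C ((P * J * S) i l) * X l) =
      ∑ i', algebraMap ℂ (LaurentSeries ℂ) (P i i') * T i' := fun i => by
    rw [← Linh_eq, hB]
    simp only [map_sum, map_mul, aeval_C, map_sub, aeval_q_Γt]
    rw [← Finset.sum_add_distrib]
    exact Finset.sum_congr rfl fun i' _ => by ring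
  -- the `Y_0²`-coefficients
  have hκS : (fun j => S j 0) = κ := funext hS0
  have coeff_B : ∀ i, coeff (Finsupp.single 0 2) (B i) =
      ∑ i', P i i' * eval κ (homogeneousComponent 2 (Γ i')) := fun i => by
    rw [hB]
    simp only [coeff_sum, coeff_C_mul, coeff_sub]
    refine Finset.sum_congr rfl fun i' _ => ?_
    rw [Lin_eq, coeff_single_two_linear, sub_zero, hΓt, hlam]
    simp only
    rw [crossCap_kernelCoefficient n₀ (Γ i') (hΓ i') y₀ S, hκS]
  refine ⟨P, P', B, q, hPP', hP'P, B_mem, fun j g hg => q_mem j g (by exact_mod_cast hg),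
    fun j' => ?_, ?_, ?_, ?_⟩
  · have := aeval_B j'.succ.succ
    rwa [linear_E_succ_succ (P * J * S) hE0 hEs j', aeval_X, add_comm] at this
  · have := aeval_B 0
    rwa [linear_E_zero (P * J * S) hE0 hEs, map_zero, add_zero] at this
  · have := aeval_B 1
    rwa [linear_E_one (P * J * S) hE0 hEs, map_zero, add_zero] at this
  · -- the cross-cap condition
    by_contra h
    push Not at h
    obtain ⟨h0, h1⟩ := h
    apply hcross
    set β : Fin (n₀ + 2) → ℂ := fun i' => eval κ (homogeneousComponent 2 (Γ i')) with hβ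
    set vh : Fin (n₀ + 1) → ℂ := Fin.cons 0 (fun j' => coeff (Finsupp.single 0 2) (B j'.succ.succ))
      with hvh
    have key : P.mulVec β = (P * J * S).mulVec vh := by
      funext i
      have lhs : P.mulVec β i = coeff (Finsupp.single 0 2) (B i) := by
        rw [coeff_B]; rfl
      have rhs : (P * J * S).mulVec vh i =
          ∑ l' : Fin n₀, (if i = l'.succ.succ then 1 else 0) * coeff (Finsupp.single 0 2) (B l'.succ.succ) := by
        simp only [Matrix.mulVec, dotProduct, Fin.sum_univ_succ, hE0, zero_mul, zero_add, hEs, hvh,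
          Fin.cons_zero, Fin.cons_succ]
      rw [lhs, rhs]
      refine Fin.cases ?_ (fun i₁ => ?_) i
      · rw [h0]
        exact (Finset.sum_eq_zero fun l' _ => by rw [if_neg (Fin.succ_ne_zero _).symm, zero_mul]).symm
      · refine Fin.cases ?_ (fun j' => ?_) i₁
        · rw [Fin.succ_zero_eq_one, h1]
          refine (Finset.sum_eq_zero fun l' _ => ?_).symm
          rw [if_neg, zero_mul]
          rw [← Fin.succ_zero_eq_one, Fin.succ_inj]
          exact (Fin.succ_ne_zero _).symm
        · rw [Finset.sum_eq_single j']
          · simp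
          · intro l' _ hl'
            rw [if_neg (fun h => hl' (Fin.succ_injective _ (Fin.succ_injective _ h)).symm), zero_mul]
          · simp
    have hβ' : β = J.mulVec (S.mulVec vh) := by
      have := congrArg P'.mulVec key
      rwa [Matrix.mulVec_mulVec, Matrix.mulVec_mulVec, hP'P, Matrix.one_mulVec, ← Matrix.mul_assoc,
        ← Matrix.mul_assoc, hP'P, Matrix.one_mul, ← Matrix.mulVec_mulVec] at this
    refine ⟨S.mulVec vh, fun i => ?_⟩
    have := congrFun hβ' i
    rw [hJmul] at this
    exact this

end Summit.ValiantsHypothesis.ValiantsHypothesis.Theorems.BinomialCandidateStubs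

end
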